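import Literature.MathematicalPhysics.QuantumFieldTheory.Balaban1983to89.Node00.Record9
import Literature.MathematicalPhysics.QuantumFieldTheory.Balaban1983to89.Node00.ContinuousTransportOfRecord

/-!
# NODE 00 (YM-PLAN Track A) — STAGE 10: the β RE-POINT — the Stage-9 record with `βfun := betaOfRecord₉c` (β read through the CONTINUOUS-VERSION
# transport `TcOfRecord` and def-χ's fixed-threshold χ), the action side over def-B's transport-generic layer AT `TcOfRecord`, and the β-VERSION
# PROVISO `HasContTransportAlong` INSIDE the displayed provisos; the record predicate `IsRecordOfRecord₁₀C`, its faces, its ₅C shadow refinement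

Cell `pub-ymgap`, NODE 00, definer seat ₇b∕₉∕₁₀ (`pub-ymgap-node00-def-T`).  [I] = [Balaban1987RG1], [III] = [Balaban1988Convergent], [IV] = [Balaban1989LargeFieldI],
[II′] = [Balaban1989LargeFieldII].  Director LINE №44 (RIDER №6 «β-VERSION» (a)(b)) ∕ LINE №45 (2); plan WORD-INTENT4 (c1).

WHAT THIS FILE IS.  `Record9` fixed the density tower (the represented tower of record) but kept Stage 8's β: `β₉ = β₈` reads every input
`A_{k+1}(V) = log(𝐍_k⁻¹ · (T_k(χ_k e^{−GF∕g_k²+A_k}))(V))`, `𝐍_k = (T_k(…))(1)` ((0.19) [I]) through the Stage-5 transport of record — POINT VALUES of an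
a.e.-defined object (RIDER №6 (b)) — and through the flow-keyed χ (RIDER №6 (a)).  Stage 10 is the Stage-9 record OVER THE SAME PARAMETERS `Stage9Params`
with exactly THREE changes, each a NEW declaration (Record9 is untouched):
* (β) `betaOfRecord₁₀ θ := betaOfRecord₉c θ` (`Node00/ContinuousTransportOfRecord`): [I] (1.20)–(1.22) on the merged term (1.6) with every `A_{k+1}`, `𝐍_k` read
  through `TcOfRecord` — THE continuous representative of the kernel transform's a.e.-class w.r.t. product Haar measure (`TcOfRecord_eq_of_continuous`:
  determined at EVERY `V`; `TcOfRecord_eq_contVersion_of_ae_eq`: independent of the version) — and def-χ's `chiFixed7` (flow-blind thresholds); the ONE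
  history `gOfRecord₁₀ θ p := genSeq β₁₀ g₀` and `EOfRecord₁₀` along it feed `χ_k`, the slots, the weights AND the flow, so §2's represented tower
  (`reprOfRecord₁₀`, `densOfRecord₁₀ = eval rep_k`, `tdensOfRecord₁₀`, the pinned 𝐑-carriers `VOfRecord₁₀`) is FILE 2's at the new plugs (`wOfRecord₉` reused).
* (χ∕T) the ACTION SIDE of the core re-pointed CONSISTENTLY to def-B's transport-generic layer (`Node00/BackgroundActionT`) AT `TcOfRecord` with def-χ's χ:
  `effAction := effActionOfRecordT (TcOfRecord) (chiFixed7 θ.ν) β₁₀`, `Ek := EkOfRecordT …`, `Repr ∕ IndAss := ReprAOfRecordT ∕ IndAOfRecordT …`,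
  `χ := chiFixed7 θ.ν` (= `chiFixAltOfRecord`, def-χ's «chi7 → chiFixed7» swap); `wilsonBG`, `dom` unchanged (§3 `residualOfStage10`, `coreOfRecord₁₀`).
* (P) `Stage9Params.Provisos₁₀`: the five tower clauses of `Provisos₉` RESTATED ALONG `gOfRecord₁₀ ∕ EOfRecord₁₀` (the sequence-of-record types are
  history-indexed) + `contT : θ.toStage8Params.HasContTransportAlong` — plan (c1): FILE 4's located existence hypothesis («the β-layer's transported densities
  have transforms admitting a continuous version, every `K`, history, `k < K`») INSIDE the provisos, so a ₁₀C record CERTIFIES it (§4).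
§5 the tower `towerOfRecord₁₀`, the datum `datumOfRecord₁₀ := datumOfTower (coreOfRecord₁₀ θ) (towerOfRecord₁₀ θ h)` and the faces of ₉ under the ₁₀ names
(`βfun_datumOfRecord₁₀ = betaOfRecord₉c θ`, `actions_stage10`, `indAss_stage10_iff`, `repr_stage10_iff` at the transport-generic objects, `chi_stage10`); §6
`IsRecordOfRecord₁₀C D w := ∃ θ (h : θ.Provisos₁₀), θ.Admissible ∧ D = datumOfRecord₁₀ θ h ∧ w.C = D.C ∧ (0 < w.γ ∧ w.γ ≤ θ.γ) ∧ w.L = θ.L ∧ ∀ P, w.up P =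
upOfRecord₅C (θ.toStage5₁₀) P`; §7 the SHADOW device of ₉ verbatim (`Residual₅` carries β ∕ χ ∕ the actions as free fields, so the machine of the shadow has
core `= coreOfRecord₁₀ θ` by `rfl` and the ₅C refinement AT THE SHADOW survives, with every world-reading ₅C theorem transferred); §8 THE β-VERSION FACES
(what `contT` buys): every β-input `T_k(χ_k e^{−GF∕g_k²+A_k})` read through `TcOfRecord` IS a version of FILE 1's kernel transform AND continuous, and IS any
continuous a.e.-representative — so `A_{k+1}` and `𝐍_k` are functions of the a.e.-CLASS of print's (0.13) transform, at every `V` and at `V = 1`.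

-- ERRATUM (def-T g2, pub-ymgap bus l.10987) to `Record9`'s module docstring («no `rnDeriv` in any object of record») and to `trho_datumOfRecord₉`'s
docstring («no `rnDeriv`»): TOO STRONG.  The Stage-9 transport is FILE 1's `transportOfRecord = transportK (avOfRecord …).avg = kernelTransport`, whose
marginal density `margDensity := rnNN (jointLaw ν avg).fst μ` IS a Radon–Nikodym version (`T4TermReprCoupling`), multiplied by a `condKernel` integral.
TRUE STATEMENT: no Stage-5 `rnTransport`; the transport has the KERNEL FORM of (0.13) [I] ∕ (3.1) [III]; its point values are version values.  This file
repairs the point-value dependence WHERE IT IS READ — the β-layer — by `TcOfRecord`; the tower's slots keep FILE 1's kernel transport (a.e.-objects under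
integrals); under `contT` the two agree a.e. at every β-input (`betaInput_ae_eq_and_continuous₁₀`).  A tower re-point to `TcOfRecord` would be FILE 1∕2
rewiring and is not claimed here.

## HONEST FRAMING — what this is NOT

* Definitions of record and kernel bookkeeping (`rfl` ∕ `Iff.rfl` faces, instantiated adapters).  NOTHING of Bałaban's is asserted: the provisos — now
  including the β-version proviso `contT` — are DISPLAYED HYPOTHESES inside an existential clause a record must CERTIFY; Theorems 1–2 [III], (2.19)–(2.44)
  [III], (1.1)–(1.2) [IV], the estimates and the analyticity statements of [I] (which are what would DISCHARGE `contT`: p. 259–260) are NOT asserted; no node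
  count moves.
* LOCATED: `IsRecordOfRecord₁₀C → IsRecordOfRecord₉C` does NOT hold AT THE DATUM (β differs ⇒ flows, histories and densities differ: two `FiniteEpsData`
  terms); what holds is the ₅C refinement AT THE SHADOW with the SAME `C`, `dens`, `βfun`, `av` (`exists_isRecordOfRecord₅C_of_isRecordOfRecord₁₀C`).
* VACUITY STATUS: as ₉ — `IsRecordOfRecord₁₀C` is inhabited iff SOME admissible `θ` satisfies `Provisos₁₀`; `contT` quantifies over ALL histories
  `g : ℕ → ℝ` (β is a FUNCTION of histories — `mergedTermFamilyT … k hist := mergedTermT … (extd hist) …` — so continuity is needed along every history β is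
  evaluated at; the `∀ g` form is a harmless superset that only makes the clause harder to certify, never vacuous-true).  SHARP χ (FILE 4 §4 honest note):
  continuity at every `V` asks the small-field boundary to be fibre-null at every `V`; an on-domain variant is a successor option, not typed here.  JUNK:
  off `contT`, `TcOfRecord … = 0` where no continuous version exists (then `A_{k+1} = log 0 = 0` by Mathlib's junk `Real.log 0 = 0`) — never read by a face of
  record, since the record asserts `contT`.
* RIDER №7 «N ≥ 2 ON K0» (director LINE №51): this file is N-GENERIC (`[NeZero N]`) and states NO K0.  At `N = 1` (`SU 1` one point, every configuration
  space a singleton) `Provisos₁₀` — `contT` included (every function on a one-point space is continuous) — is closable by pure typing (n23-b's census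
  pattern), so ₁₀'s provisos do NOT exclude the degenerate group; the R447 obligation is INHABITED-AT-₁₀C (resp. its successor) AT THE GROUP OF RECORD,
  `N ≥ 2` — the route instantiates `F 2` — and `exists_world_isRecordOfRecord₁₀C` below is a hypothesis-driven lemma, not an inhabitation claim.
* K0 AT `N ≥ 2`, LOCATED (dag-n23-b census `K0-TYPING-CENSUS.md` v1.1 52242cbe91f92ff7): the five INHERITED clauses (`intPiece`, `measω`, `measChi`,
  `rstep` conj. 1∕3∕4) are stated — here exactly AS AT ₉, option (i) «inherits as typed» — on objects that READ REPRESENTATIVES: def-R's totalised (2.12)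
  solution map (`UminOfRecord`, a `Classical.choose`) inside every χ and step weight, and Mathlib's `rnDeriv` version inside FILE 1's kernel transport
  (`margDensity`) in every T-slot of level ≥ 1; so at the group of record they are closable only through choice-independence theorems or after a
  definition-side re-point of those objects (census §3 (R-b) solution map with a regularity field; (R-c) a pointwise-determined T-step — this seat's
  `contVersion` pattern applied to the TOWER, DEDUP №11a's transport-generic `TkOfRecord`), or softened statement-side to a.e.∕essential forms (R-a).
  None of that is done here (this file owes the β re-point); it is successor work (`Record11` ∕ def-R successor ∕ 11a), SAID so nobody reads
  `Provisos₁₀` at `N ≥ 2` as an «analytic estimate away» from inhabited.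
* The §2 [III] format slot `S218` and `ScorrLaw` are still RESIDUAL predicates read at the objects of record (FORMAT FACE №38 as at ₉: junk-closable over
  `IsRecordOfRecord₁₀C` ALONE); their pin is DEDUP №11 (`Node00/Sect2FormOfRecord`, then `Record11`).  CARRIERS: as at ₉ (only `V` pinned; node00-def g29's
  suffix recipe `pinB10` ∕ `₁₀CB10` re-instantiates verbatim — no new fields).
* One finite four-torus programme at fixed `ε` — NOT the continuum limit on ℝ⁴, NOT infinite volume, NOT OS, NOT a mass gap, NOT the Clay problem.
-/

noncomputable section

open MeasureTheory
open scoped Matrix.Norms.L2Operator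

namespace Literature.MathematicalPhysics.QuantumFieldTheory.Balaban1983to89.Node00

open T4Continuum AveragingRT T4FiniteEpsInhabited FlowStep FlowStepRuns DagBinding T4DatumAssembly
open B12Eq019ActionBody (integrand)

variable (F : T4Family) (N : ℕ) [NeZero N]

/-! ## §1. Parameters and admissibility: `Stage9Params`, `Stage9Params.Admissible` of `Record9`, REUSED BY NAME (no new fields at Stage 10) -/

/-! ## §2. The θ-keyed plugs into the represented tower of record -/

/-- **The β-functions of record at Stage 10 ARE FILE 4's `betaOfRecord₉c`**: [I] (1.20)–(1.22) on the merged term (1.6) with every input `A_{k+1}` read through the CONTINUOUS-VERSION transport `TcOfRecord` and def-χ's fixed-threshold `chiFixed7` (RIDER №6 (a)(b)). [cite: Balaban1987RG1, (1.20)–(1.22) p.264 (bookkeeping)] -/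
abbrev betaOfRecord₁₀ (θ : Stage9Params F N) : HBeta :=
  betaOfRecord₉c F N θ

/-- The GENERATED HISTORY of the run `p`: `g_k := genSeq β₁₀ g₀ k` ((0.17)–(0.20) forward) — the ONE history fed to `χ_k`, the slots, the weights AND the flow.
[cite: Balaban1987RG1, (0.17)–(0.20) pp.255–256] -/
abbrev gOfRecord₁₀ (θ : Stage9Params F N) (p : B12.RunParams) : ℕ → ℝ :=
  genSeq (betaOfRecord₁₀ F N θ) p.g0

/-- The normalisation `E(p)` of `ρ₀` at Stage 10 = Stage 8's `EOfRecord` along the generated histories. [cite: Balaban1988Convergent, (1.15) p.249 and Thm 1 p.262 (bookkeeping)] -/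
abbrev EOfRecord₁₀ (θ : Stage9Params F N) : B12.RunParams → ℝ :=
  EOfRecord F N θ.ν θ.Efl θ.logz (fun p => genSeq (betaOfRecord₁₀ F N θ) p.g0)

/-- **`rep_k` of record at `θ`** along the run `p`: the (2.18) representation of `ρ_k` (FILE 2's `repOfRecord9` at the plugs). [cite: Balaban1988Convergent, (2.18) p.257] -/
def reprOfRecord₁₀ (θ : Stage9Params F N) (p : B12.RunParams) (k : ℕ) : Step.Repr218 (F.P p.K) (SU N) k :=
  repOfRecord9 F N θ.ν θ.τ9 (EOfRecord₁₀ F N θ) (wOfRecord₉ F N θ) θ.ppSel p (gOfRecord₁₀ F N θ p) k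

/-- **`Tstep rep_k` of record at `θ`**: the (2.18) representation of `𝐓ρ_k` BEFORE the R-step ((3.25) [III]). [cite: Balaban1988Convergent, (3.25) p.270] -/
def reprTOfRecord₁₀ (θ : Stage9Params F N) (p : B12.RunParams) (k : ℕ) : Step.Repr218 (F.P p.K) (SU N) (k + 1) :=
  repTOfRecord9 F N θ.ν θ.τ9 (EOfRecord₁₀ F N θ) (wOfRecord₉ F N θ) θ.ppSel p (gOfRecord₁₀ F N θ p) k

/-- **`ρ_k := eval rep_k`** — THE DENSITY OF RECORD at Stage 10, an explicit function of the field. [cite: Balaban1988Convergent, (2.18) p.257 and (0.2) p.244] -/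
def densOfRecord₁₀ (θ : Stage9Params F N) (p : B12.RunParams) (k : ℕ) : Density (F.P p.K) k (SU N) :=
  rhoOfRecord9 F N θ.ν θ.τ9 (EOfRecord₁₀ F N θ) (wOfRecord₉ F N θ) θ.ppSel p (gOfRecord₁₀ F N θ p) k

/-- **`𝐓ρ_k := eval (Tstep rep_k)`** — the T-stepped density of record, EXPLICIT. [cite: Balaban1988Convergent, (3.1) p.264 and (3.25) p.270] -/
def tdensOfRecord₁₀ (θ : Stage9Params F N) (p : B12.RunParams) (k : ℕ) : Density (F.P p.K) (k + 1) (SU N) :=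
  trhoOfRecord9 F N θ.ν θ.τ9 (EOfRecord₁₀ F N θ) (wOfRecord₉ F N θ) θ.ppSel p (gOfRecord₁₀ F N θ p) k

/-- (2.18) holds for `ρ_k` with `rep_k` of record, BY CONSTRUCTION. [cite: Balaban1988Convergent, (2.18) p.257 (bookkeeping)] -/
theorem holds_densOfRecord₁₀ (θ : Stage9Params F N) (p : B12.RunParams) (k : ℕ) :
    (reprOfRecord₁₀ F N θ p k).Holds (densOfRecord₁₀ F N θ p k) :=
  holds_repOfRecord9 F N θ.ν θ.τ9 _ _ θ.ppSel p _ k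

/-- (2.18) holds for `𝐓ρ_k` with `Tstep rep_k` of record, BY CONSTRUCTION. [cite: Balaban1988Convergent, (3.25) p.270 (bookkeeping)] -/
theorem holds_tdensOfRecord₁₀ (θ : Stage9Params F N) (p : B12.RunParams) (k : ℕ) :
    (reprTOfRecord₁₀ F N θ p k).Holds (tdensOfRecord₁₀ F N θ p k) :=
  holds_repTOfRecord9 F N θ.ν θ.τ9 _ _ θ.ppSel p _ k

/-- `ρ₀` of record is the Wilson start `e^{−E(p)}·exp(−A∕g₀²)` at the run's bare coupling. [cite: Balaban1988Convergent, Thm 1 p.262] -/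
theorem densOfRecord₁₀_zero (θ : Stage9Params F N) (p : B12.RunParams) :
    densOfRecord₁₀ F N θ p 0 = rhoZeroOfRecord F N p.K p.g0 (EOfRecord₁₀ F N θ p) := by
  rw [densOfRecord₁₀, rhoOfRecord9_zero]
  exact congrArg (fun x => rhoZeroOfRecord F N p.K x (EOfRecord₁₀ F N θ p)) (genSeq_zero _ _)

/-- `ρ_{k+1}` of record IS the slice density of def-R's R-stepped pre-𝐑 slot (`rfl`; FILE 2's `rhoOfRecord9_succ`). [cite: Balaban1989LargeFieldI, (0.3) p.176 (bookkeeping)] -/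
theorem densOfRecord₁₀_succ (θ : Stage9Params F N) (p : B12.RunParams) (k : ℕ) :
    densOfRecord₁₀ F N θ p (k + 1)
      = densityOfSlice F N θ.ν θ.τ9.M p (gOfRecord₁₀ F N θ p) (k + 1)
          (rstepSlotOfRecord F N θ.ν θ.τ9 θ.ppSel p (gOfRecord₁₀ F N θ p) (k + 1)
            (slotsTOfRecord F N θ.ν θ.τ9 (EOfRecord₁₀ F N θ) (wOfRecord₉ F N θ) θ.ppSel p (gOfRecord₁₀ F N θ p) (k + 1))) := rfl

/-! ## §2b. The 𝐑-carriers PINNED FROM THE TOWER; the Stage-5 view of record -/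

/-- **`SLaw₁₀ θ P j`** — the §2 [III] format law of `ρ_j` OF RECORD: the residual predicate `S218` READ AT `densOfRecord₁₀ θ P j` (the core's `Sect2Form P j`,
verbatim). [cite: Balaban1988Convergent, (2.18) p.257 with (2.23)–(2.44) (the predicate, read at the object of record)] -/
def SLaw₁₀ (θ : Stage9Params F N) (p : B12.RunParams) (j : ℕ) : Prop :=
  θ.res.S218 p j (densOfRecord₁₀ F N θ p j)

/-- **`TLaw₁₀ θ P k`** — the «corresponding space» law of `𝐓ρ_k` OF RECORD: the residual predicate `ScorrLaw` READ AT `tdensOfRecord₁₀ θ P k`.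
[cite: Balaban1988Convergent, remark p.262 and Def. 3 p.279 (the predicate, read at the object of record)] -/
def TLaw₁₀ (θ : Stage9Params F N) (p : B12.RunParams) (k : ℕ) : Prop :=
  θ.ScorrLaw p k (tdensOfRecord₁₀ F N θ p k)

/-- **THE 𝐑-CARRIERS OF THE RUN `P`, PINNED ALONG THE REPRESENTED TOWER OF RECORD** (dag-n13-a's along-the-tower pin): lattice data `F.P P.K`, group `SU(N)`,
`K := P.K`; target space `S j ρ :↔ ρ = ρ_j ∧ SLaw₁₀ θ P j`; corresponding space `Scorr (k+1) ρ' :↔ ρ' = 𝐓ρ_k ∧ TLaw₁₀ θ P k`, `Scorr 0 :≡ ⊥`; density operation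
`R k :=` the operation INDUCED by the R-step — `𝐓ρ_k ↦ ρ_{k+1}`, identity elsewhere (`T4DatumAssembly.inducedAt`; = the tower's `inducedR`).  Hypothesis-free.
So bound, [III] p. 244's leaf `ROpLeaf` IS law transport along the tower (`rOpLeaf_VOfRecord₁₀_iff`) — content exactly that of the residual laws `ScorrLaw` ∕ `S218`
(pinned by the §2-format file `Node00/Sect2FormOfRecord`, not here). [cite: Balaban1988Convergent, p.244 and remark p.262; Balaban1989LargeFieldI, (0.2)–(0.3) p.176] -/
def VOfRecord₁₀ (θ : Stage9Params F N) (p : B12.RunParams) : PrintedCarriers14R where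
  P := F.P p.K
  G := SU N
  instGG := inferInstance
  instMS := inferInstance
  instHD := inferInstance
  K := p.K
  R := fun k => inducedAt (tdensOfRecord₁₀ F N θ p k) (densOfRecord₁₀ F N θ p (k + 1))
  Scorr := fun j ρ' => match j with
    | 0 => False
    | k + 1 => ρ' = tdensOfRecord₁₀ F N θ p k ∧ TLaw₁₀ F N θ p k
  S := fun j ρ => ρ = densOfRecord₁₀ F N θ p j ∧ SLaw₁₀ F N θ p j

/-- The pinned density operation maps `𝐓ρ_k ↦ ρ_{k+1}` ((0.2)∕(0.3) at the objects of record). [cite: Balaban1989LargeFieldI, (0.2)–(0.3) p.176 (bookkeeping)] -/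
theorem R_VOfRecord₁₀_tdens (θ : Stage9Params F N) (p : B12.RunParams) (k : ℕ) :
    (VOfRecord₁₀ F N θ p).R k (tdensOfRecord₁₀ F N θ p k) = densOfRecord₁₀ F N θ p (k + 1) :=
  inducedAt_self _ _

/-- **[III] p. 244's LEAF AT THE PINNED CARRIERS IS LAW TRANSPORT ALONG THE TOWER**: `ROpLeaf (VOfRecord₁₀ θ P) ↔ ∀ k < K, TLaw₁₀ θ P k → SLaw₁₀ θ P (k+1)` — «`𝐑𝐓ρ_k`,
`𝐓ρ_k` in the corresponding space, has the form (2.18) with the §2 conditions» read at the objects of record (dag-n13-a module 8 §2's reading; here direct from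
`DagBinding.rOpLeaf_iff`). [cite: Balaban1988Convergent, p.244 and remark p.262; Balaban1989LargeFieldII, Thm 1 p.355 (what the leaf says; bookkeeping)] -/
theorem rOpLeaf_VOfRecord₁₀_iff (θ : Stage9Params F N) (p : B12.RunParams) :
    ROpLeaf (VOfRecord₁₀ F N θ p) ↔ ∀ k, k < p.K → TLaw₁₀ F N θ p k → SLaw₁₀ F N θ p (k + 1) := by
  rw [rOpLeaf_iff]
  refine ⟨fun h k hk hT => ?_, fun h k hk ρ' hρ' => ?_⟩
  · have hS := h k hk (tdensOfRecord₁₀ F N θ p k) ⟨rfl, hT⟩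
    rw [R_VOfRecord₁₀_tdens] at hS
    exact hS.2
  · obtain ⟨rfl, hT⟩ := hρ'
    show (VOfRecord₁₀ F N θ p).S (k + 1) ((VOfRecord₁₀ F N θ p).R k (tdensOfRecord₁₀ F N θ p k))
    rw [R_VOfRecord₁₀_tdens]
    exact ⟨rfl, h k hk hT⟩

/-- **THE STAGE-10 RESIDUAL**: Stage 8's residual with the 𝐑-carriers `V := VOfRecord₁₀ θ` PINNED FROM THE TOWER and THE β RE-POINT: `βfun := betaOfRecord₁₀ θ`
(= `betaOfRecord₉c θ`), `E := EOfRecord₁₀ θ`, `χ := chiFixed7 θ.ν` along `gOfRecord₁₀`, and the four action∕format fields over def-B's transport-generic layer AT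
`TcOfRecord` (`effActionOfRecordT`, `EkOfRecordT`, `ReprAOfRecordT`, `IndAOfRecordT`); `dom`, `wilsonBG`, `R`, `S218` inherited.  LOCATED (TS-9⁺, R9-a): the carrier groups `X` ([B8]∕[B10]∕B12∕B13), `Y` [B9], `Z` [B11], `W` [IV] stay RESIDUAL free data at Stage 10 — the datum,
the provisos and admissibility never read them — so no universal node statement reading those leaves is a closer target over `IsRecordOfRecord₁₀C`; their
pins from objects of record are the carrier-pinning successor record. [cite: Balaban1988Convergent, p.244; Balaban1989LargeFieldI, (0.2)–(0.6) pp.176–177 (dictionary; bookkeeping)] -/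
def residualOfStage10 (θ : Stage9Params F N) : Residual₅ F N :=
  { residualOfStage8 F N θ.toStage8Params with
    V := VOfRecord₁₀ F N θ
    βfun := betaOfRecord₁₀ F N θ
    χ := fun p k => chiFixed7 F N θ.ν p.K (gOfRecord₁₀ F N θ p) k
    E := EOfRecord₁₀ F N θ
    effAction := effActionOfRecordT F N (TcOfRecord F N) (chiFixed7 F N θ.ν) (betaOfRecord₁₀ F N θ)
    Ek := EkOfRecordT F N (TcOfRecord F N) (chiFixed7 F N θ.ν) θ.εbg (betaOfRecord₁₀ F N θ)
    ReprA := ReprAOfRecordT F N (TcOfRecord F N) (chiFixed7 F N θ.ν) θ.εbg (betaOfRecord₁₀ F N θ)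
    IndA := IndAOfRecordT F N (TcOfRecord F N) (chiFixed7 F N θ.ν) θ.εbg (betaOfRecord₁₀ F N θ) }

/-- **The Stage-5 VIEW of Stage-9 parameters, Stage-10 residual** (what the record's upstream block is bound over): `θ`'s Stage-3 dictionary and `γ`, residual := `residualOfStage10 θ`.
[cite: Balaban1989LargeFieldII, Thm 1 p.355 (bookkeeping)] -/
def Stage9Params.toStage5₁₀ (θ : Stage9Params F N) : Stage5Params F N :=
  { θ.toStage5Params with res := residualOfStage10 F N θ }

/-- The view's 𝐑-carriers ARE the pinned ones (`rfl`). [cite: Balaban1988Convergent, p.244 (bookkeeping)] -/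
theorem Stage9Params.toStage5₁₀_res_V (θ : Stage9Params F N) (p : B12.RunParams) : (θ.toStage5₁₀ F N).res.V p = VOfRecord₁₀ F N θ p := rfl

/-- **THE RECORD'S 𝐑-LEAF, UNFOLDED**: at the C-binding of record over the Stage-10 view, the run's `rOperation` leaf IS law transport along the tower of record.
[cite: Balaban1988Convergent, p.244; Balaban1989LargeFieldII, Thm 1 p.355 (bookkeeping)] -/
theorem rOperation_upOfRecord₅C_stage10_iff (θ : Stage9Params F N) (p : B12.RunParams) :
    (upOfRecord₅C F N (θ.toStage5₁₀ F N) p).rOperation ↔ ∀ k, k < p.K → TLaw₁₀ F N θ p k → SLaw₁₀ F N θ p (k + 1) := by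
  show ROpLeaf (VOfRecord₁₀ F N θ p) ↔ _
  exact rOpLeaf_VOfRecord₁₀_iff F N θ p

/-! ## §3. The core of record (hypothesis-free) -/

/-- **THE CORE OF RECORD at `θ`** (`RGMachineCore`, by hand): the β of record, `E`, def-R's domains and `χ` along the generated histories, def-B's background
Wilson action ∕ effective action ∕ expansion term and the two action-side format predicates AT THE OBJECTS (Stage 8 verbatim), and the §2 [III] clause
`Sect2Form p k := S218 p k ρ_k` READ AT THE REPRESENTED DENSITY `densOfRecord₁₀ θ p k` — never a free truth value. [cite: Balaban1987RG1, (0.17)–(0.24) pp.255–257 and Thm 3 p.264; Balaban1988Convergent, (2.17)–(2.18) p.257; Balaban1989LargeFieldII, Thm 1 p.355 (the clauses, read at the objects)] -/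
def coreOfRecord₁₀ (θ : Stage9Params F N) : RGMachineCore F (SU N) where
  βfun := betaOfRecord₁₀ F N θ
  E := EOfRecord₁₀ F N θ
  dom := fun p k => domAltOfRecord F N θ.ν p.K k
  effAction := effActionOfRecordT F N (TcOfRecord F N) (chiFixed7 F N θ.ν) (betaOfRecord₁₀ F N θ)
  wilsonBG := wilsonBGOfRecord F N θ.εbg
  Ek := EkOfRecordT F N (TcOfRecord F N) (chiFixed7 F N θ.ν) θ.εbg (betaOfRecord₁₀ F N θ)
  χ := fun p k => chiFixed7 F N θ.ν p.K (gOfRecord₁₀ F N θ p) k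
  Repr := fun p k => ReprAOfRecordT F N (TcOfRecord F N) (chiFixed7 F N θ.ν) θ.εbg (betaOfRecord₁₀ F N θ) p k (prefixOf (gOfRecord₁₀ F N θ p) k)
    (domAltOfRecord F N θ.ν p.K k) (effActionOfRecordT F N (TcOfRecord F N) (chiFixed7 F N θ.ν) (betaOfRecord₁₀ F N θ) p k)
    (wilsonBGOfRecord F N θ.εbg p k) (EkOfRecordT F N (TcOfRecord F N) (chiFixed7 F N θ.ν) θ.εbg (betaOfRecord₁₀ F N θ) p k)
  IndAss := fun p k => IndAOfRecordT F N (TcOfRecord F N) (chiFixed7 F N θ.ν) θ.εbg (betaOfRecord₁₀ F N θ) p k (prefixOf (gOfRecord₁₀ F N θ p) k)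
    (domAltOfRecord F N θ.ν p.K k) (effActionOfRecordT F N (TcOfRecord F N) (chiFixed7 F N θ.ν) (betaOfRecord₁₀ F N θ) p k)
    (wilsonBGOfRecord F N θ.εbg p k) (EkOfRecordT F N (TcOfRecord F N) (chiFixed7 F N θ.ν) θ.εbg (betaOfRecord₁₀ F N θ) p k)
  Sect2Form := fun p k => θ.res.S218 p k (densOfRecord₁₀ F N θ p k)

/-- The core's Wilson start IS `ρ₀` of record (`densOfRecord₁₀_zero` read at the core; `rfl` up to it). [cite: Balaban1988Convergent, Thm 1 p.262 (bookkeeping)] -/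
theorem rhoZero_coreOfRecord₁₀ (θ : Stage9Params F N) (p : B12.RunParams) :
    (coreOfRecord₁₀ F N θ).rhoZero p = densOfRecord₁₀ F N θ p 0 := by
  rw [densOfRecord₁₀_zero]
  rfl

/-! ## §4. The displayed provisos of the tower of record -/

/-- **THE DISPLAYED PROVISOS of the represented tower of record at `θ`** — HYPOTHESES under which the tower's two Bochner-integral faces are print's
statements (never admissibility clauses, never fields of an object): `intPiece` — the level-`k` pieces `χ_k(s)·slot_k(s)` of `ρ_k` are integrable
(`k < K`; at `k = 0` a theorem, `intPiece_zero`); `measω` — n02-b's (O4): the (3.2)–(3.9)·(3.16) label weights are jointly measurable in `(V′, U)` (def-R's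
(2.12) minimiser is a classical-choice function); `measChi` — the new front factors `χ_{k+1}(s′)` are measurable (same reason); `zetaUnity` ∕ `zetaAbs` — the
two displayed laws of the residual `ζ` ((3.16) resolves unity, (3.21)); `rstep` — def-R's (0.3) provisos of the pre-𝐑 tower of record at every level
`k+1 ≤ K` (measurable, non-negative, uniformly bounded pieces, nowhere-vanishing denominators), instance-generic in `DecidableEq (PBond …)` — all five
STATED ALONG THE STAGE-10 HISTORIES `gOfRecord₁₀` ∕ `EOfRecord₁₀`; and NEW AT STAGE 10, `contT` — **THE β-VERSION PROVISO** (plan (c1), RIDER №6 (b)):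
`θ.toStage8Params.HasContTransportAlong`, i.e. at every torus `K`, history `g`, step `k < K` the kernel transform (0.13) of the β-layer's density
`χ_k·exp(−GF∕g_k² + A_k)` (with `A_k` built over `TcOfRecord`, `chiFixed7`) admits a CONTINUOUS VERSION w.r.t. product Haar measure — what [I] pp.259–260
(analyticity of `T_k` images on the small-field domains) would discharge; NOT asserted. [cite: Balaban1988Convergent, (2.18) p.257, (3.2)–(3.9) pp.265–266, (3.16) p.268, (3.20)–(3.21) p.269; Balaban1989LargeFieldI, (0.3)–(0.4) p.176; Balaban1987RG1, (0.13) p.254, (0.19) p.255, pp.259–260] -/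
structure Stage9Params.Provisos₁₀ (θ : Stage9Params F N) : Prop where
  /-- the level-`k` pieces `χ_k(s)·slot_k(s)` of `ρ_k` are integrable, `k < K` -/
  intPiece : ∀ (p : B12.RunParams) (k : ℕ), k < p.K → ∀ s : SeqOfRecord F θ.ν θ.τ9.M (gOfRecord₁₀ F N θ p) p.K k,
    Integrable (fun U => chiSeqOfRecord F N θ.ν θ.τ9.M (gOfRecord₁₀ F N θ p) p.K k s U *
      slotsOfRecord F N θ.ν θ.τ9 (EOfRecord₁₀ F N θ) (wOfRecord₉ F N θ) θ.ppSel p (gOfRecord₁₀ F N θ p) k s U) (fieldMeasure (F.P p.K) k (SU N))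
  /-- (O4): the label weights `ω = a·b·ζ` are jointly measurable in `(V′, U)`, `k < K` -/
  measω : ∀ (p : B12.RunParams) (k : ℕ), k < p.K → ∀ (s : SeqOfRecord F θ.ν θ.τ9.M (gOfRecord₁₀ F N θ p) p.K k)
    (t : LbOfRecord F θ.ν p (gOfRecord₁₀ F N θ p) k),
    Measurable (fun z : GaugeField (F.P p.K) (k + 1) (SU N) × GaugeField (F.P p.K) k (SU N) =>
      ωOfRecord F N θ.ν θ.τ9.M p (gOfRecord₁₀ F N θ p) k θ.A₁ θ.ζ s t z.2 z.1)
  /-- the new front factors `χ_{k+1}(s′)` are measurable, `k < K` -/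
  measChi : ∀ (p : B12.RunParams) (k : ℕ), k < p.K → ∀ s' : SeqOfRecord F θ.ν θ.τ9.M (gOfRecord₁₀ F N θ p) p.K (k + 1),
    Measurable (chiSeqOfRecord F N θ.ν θ.τ9.M (gOfRecord₁₀ F N θ p) p.K (k + 1) s')
  /-- the residual `ζ` resolves unity: `Σ_{(R,S)} ζ_{k+1}(R,S) = 1` -/
  zetaUnity : IsZetaUnity F N θ.ν θ.τ9.M θ.ζ
  /-- the residual `ζ` has `Σ_{(R,S)} |ζ_{k+1}(R,S)| ≤ 1` -/
  zetaAbs : IsZetaAbsLeOne F N θ.ν θ.τ9.M θ.ζ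
  /-- def-R's (0.3) provisos of the pre-𝐑 tower of record, SUPPORT FORM (R-C2), at every level `k+1 ≤ K`, at every instance -/
  rstep : ∀ (p : B12.RunParams) (k : ℕ) [DecidableEq (PBond (F.P p.K) (k + 1))], k < p.K →
    (towerRepOfRecord F N θ.ν θ.τ9 (slotsTOfRecord F N θ.ν θ.τ9 (EOfRecord₁₀ F N θ) (wOfRecord₉ F N θ) θ.ppSel) θ.ppSel p
      (gOfRecord₁₀ F N θ p) (k + 1)).toRepData.ProvisosSupp
  /-- **(c1) — THE β-VERSION PROVISO** (FILE 4's located existence hypothesis, INSIDE the provisos): along the continuous-version transport of record, at every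
  torus `K`, history `g` and step `k < K`, the β-layer's transported density `χ_k·exp(−GF/g_k² + A_k)` has a transform admitting a continuous version -/
  contT : θ.toStage8Params.HasContTransportAlong

variable {F N}

/-- **def-T's step provisos FROM the Stage-10 provisos** at every step `k < K`: the weight clauses `measW` ∕ `absW_le` ∕ `unity` are n02-b's three theorems on
`wOfRecord` modulo the displayed (O4) and ζ-laws. [cite: Balaban1988Convergent, (3.2)–(3.9) pp.265–266, (3.16) p.268, (3.24)–(3.25) p.270] -/
theorem Stage9Params.Provisos₁₀.tstep {θ : Stage9Params F N} (h : θ.Provisos₁₀) (p : B12.RunParams) (k : ℕ) (hk : k < p.K) :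
    TStepProvisos F N θ.ν θ.τ9 (EOfRecord₁₀ F N θ) (wOfRecord₉ F N θ) θ.ppSel p (gOfRecord₁₀ F N θ p) k where
  intPiece := h.intPiece p k hk
  measW := fun s' => measurable_wOfRecord F N θ.ν θ.τ9.M θ.A₁ θ.ζ p (gOfRecord₁₀ F N θ p) k (h.measω p k hk) s'
  absW_le := fun s' U V' => abs_wOfRecord_le_one F N θ.ν θ.τ9.M θ.A₁ h.zetaAbs p (gOfRecord₁₀ F N θ p) k s' U V'
  measChi := h.measChi p k hk
  unity := isStepUnity_wOfRecord F N θ.ν θ.τ9.M θ.A₁ h.zetaUnity p (gOfRecord₁₀ F N θ p) k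

/-- **The adapter's support-form provisos along the generated histories FROM the Stage-10 provisos** (both bundles instance-generic in
`DecidableEq (PBond …)`; the core's `E`, `βfun` ARE `EOfRecord₁₀ θ`, `betaOfRecord₁₀ θ` — `convert … <;> rfl`). [cite: Balaban1989LargeFieldI, (0.3)–(0.4) p.176 (bookkeeping)] -/
theorem Stage9Params.Provisos₁₀.genTowerProvisosSupp {θ : Stage9Params F N} (h : θ.Provisos₁₀) :
    GenTowerProvisosSupp F N θ.ν θ.τ9 (coreOfRecord₁₀ F N θ) (wOfRecord₉ F N θ) θ.ppSel where
  tstep := fun p k hk => h.tstep p k hk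
  rstep := fun p k _ hk => by convert h.rstep p k hk <;> rfl

/-- … and along the histories `gOfRecord₁₀ θ` (`GenTowerProvisosSupp.towerProvisosSupp`). [cite: Balaban1989LargeFieldI, (0.3)–(0.4) p.176 (bookkeeping)] -/
theorem Stage9Params.Provisos₁₀.towerProvisosSupp {θ : Stage9Params F N} (h : θ.Provisos₁₀) :
    TowerProvisosSupp F N θ.ν θ.τ9 (coreOfRecord₁₀ F N θ) (wOfRecord₉ F N θ) θ.ppSel (gOfRecord₁₀ F N θ) :=
  h.genTowerProvisosSupp.towerProvisosSupp

variable (F N)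

/-! ## §5. The tower and the datum of record; faces -/

/-- **THE TOWER OF RECORD at `θ` under its provisos**: the support-form adapter `towerOfRecord9GenSupp` at the core of record — `ρ p k = densOfRecord₁₀ θ p k`,
`Trho p k = tdensOfRecord₁₀ θ p k`, the three obligations def-T's three faces. [cite: Balaban1988Convergent, (0.2) p.244, (2.18) p.257, (3.25) p.270; Balaban1989LargeFieldI, (0.4) p.176] -/
def towerOfRecord₁₀ (θ : Stage9Params F N) (h : θ.Provisos₁₀) : (coreOfRecord₁₀ F N θ).Tower (avOfRecord F N) :=
  towerOfRecord9GenSupp h.genTowerProvisosSupp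

/-- **THE DATUM OF RECORD, STAGE 10**: the tower-form assembler at the core and the tower of record — construction over `eval rep_k`, realisation with the
EXPLICIT `𝐓ρ_k` and the INDUCED `𝐑`. [cite: Balaban1989LargeFieldII, Thm 1 + (0.1) pp.355–356; Balaban1988Convergent, (0.2) p.244] -/
def datumOfRecord₁₀ (θ : Stage9Params F N) (h : θ.Provisos₁₀) : FiniteEpsData F (SU N) :=
  datumOfTower F N (coreOfRecord₁₀ F N θ) (towerOfRecord₁₀ F N θ h)

/-- The tower's densities ARE `densOfRecord₁₀` (`rfl`). [cite: Balaban1988Convergent, (2.18) p.257 (bookkeeping)] -/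
theorem towerOfRecord₁₀_ρ (θ : Stage9Params F N) (h : θ.Provisos₁₀) (p : B12.RunParams) (k : ℕ) :
    (towerOfRecord₁₀ F N θ h).ρ p k = densOfRecord₁₀ F N θ p k := rfl

/-- The tower's `𝐓ρ_k` ARE `tdensOfRecord₁₀` (`rfl`). [cite: Balaban1988Convergent, (3.25) p.270 (bookkeeping)] -/
theorem towerOfRecord₁₀_Trho (θ : Stage9Params F N) (h : θ.Provisos₁₀) (p : B12.RunParams) (k : ℕ) :
    (towerOfRecord₁₀ F N θ h).Trho p k = tdensOfRecord₁₀ F N θ p k := rfl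

/-- **THE TOWER OF RECORD IS INTEGRABLE** (every `ρ_k`, `k ≤ K`) — from the displayed provisos (adapter's `isIntegrable_towerOfRecord9GenSupp`). [cite: Balaban1988Convergent, (0.2) p.244 (bookkeeping)] -/
theorem isIntegrable_towerOfRecord₁₀ (θ : Stage9Params F N) (h : θ.Provisos₁₀) : (towerOfRecord₁₀ F N θ h).IsIntegrable :=
  isIntegrable_towerOfRecord9GenSupp h.genTowerProvisosSupp

/-- FACE `dens`: the datum's densities ARE `densOfRecord₁₀` at the run `(K, F.m, g₀)` (`rfl`). [cite: Balaban1988Convergent, (2.18) p.257 (bookkeeping)] -/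
theorem dens_datumOfRecord₁₀ (θ : Stage9Params F N) (h : θ.Provisos₁₀) (K : ℕ) (g₀ : ℝ) (k : ℕ) :
    (datumOfRecord₁₀ F N θ h).dens K g₀ k = densOfRecord₁₀ F N θ ⟨K, F.m, g₀⟩ k := rfl

/-- FACE `Trho` (EXPLICIT): the datum's realised `𝐓ρ_k` ARE `tdensOfRecord₁₀` (`rfl`) — no `rnDeriv`. [cite: Balaban1988Convergent, (3.25) p.270 (bookkeeping)] -/
theorem trho_datumOfRecord₁₀ (θ : Stage9Params F N) (h : θ.Provisos₁₀) (K : ℕ) (g₀ : ℝ) (k : ℕ) :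
    (datumOfRecord₁₀ F N θ h).real.Trho K g₀ k = tdensOfRecord₁₀ F N θ ⟨K, F.m, g₀⟩ k := rfl

/-- FACE `𝐑` (INDUCED): the datum's large-field operation IS the tower's induced operation (`rfl`) … [cite: Balaban1989LargeFieldI, (0.2)–(0.3) p.176 (bookkeeping)] -/
theorem R_datumOfRecord₁₀ (θ : Stage9Params F N) (h : θ.Provisos₁₀) (K : ℕ) (g₀ : ℝ) (k : ℕ) :
    (datumOfRecord₁₀ F N θ h).real.R K g₀ k = (towerOfRecord₁₀ F N θ h).inducedR ⟨K, F.m, g₀⟩ k := rfl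

/-- … IS the pinned carriers' density operation at the run `(K, F.m, g₀)` (`rfl`) … [cite: Balaban1989LargeFieldI, (0.2)–(0.3) p.176 (bookkeeping)] -/
theorem R_datumOfRecord₁₀_eq_VOfRecord₁₀ (θ : Stage9Params F N) (h : θ.Provisos₁₀) (K : ℕ) (g₀ : ℝ) (k : ℕ) :
    (datumOfRecord₁₀ F N θ h).real.R K g₀ k = (VOfRecord₁₀ F N θ ⟨K, F.m, g₀⟩).R k := rfl

/-- … and maps `𝐓ρ_k ↦ ρ_{k+1}` ((0.2) `ρ_{k+1} = 𝐑𝐓ρ_k` at the objects of record). [cite: Balaban1988Convergent, (0.2) p.244; Balaban1989LargeFieldI, (0.3) p.176] -/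
theorem R_tdens_datumOfRecord₁₀ (θ : Stage9Params F N) (h : θ.Provisos₁₀) (K : ℕ) (g₀ : ℝ) (k : ℕ) :
    (datumOfRecord₁₀ F N θ h).real.R K g₀ k (tdensOfRecord₁₀ F N θ ⟨K, F.m, g₀⟩ k) = densOfRecord₁₀ F N θ ⟨K, F.m, g₀⟩ (k + 1) :=
  (towerOfRecord₁₀ F N θ h).inducedR_Trho ⟨K, F.m, g₀⟩ k

/-- FACE construction: the datum's `C` is the core's construction over the densities of record (`rfl`) — the term a binding world sets as its `C`.
[cite: Balaban1989LargeFieldII, Thm 1 + (0.1) pp.355–356 (bookkeeping)] -/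
theorem datumOfRecord₁₀_C (θ : Stage9Params F N) (h : θ.Provisos₁₀) :
    (datumOfRecord₁₀ F N θ h).C = (coreOfRecord₁₀ F N θ).construction (densOfRecord₁₀ F N θ) := rfl

/-- FACE β: the datum's β-functions ARE the β of record (`rfl`). [cite: Balaban1987RG1, (1.20)–(1.22) p.264 (bookkeeping)] -/
theorem βfun_datumOfRecord₁₀ (θ : Stage9Params F N) (h : θ.Provisos₁₀) : (datumOfRecord₁₀ F N θ h).βfun = betaOfRecord₁₀ F N θ := rfl

/-- FACE β AT FILE 4's NAME: the datum's β IS `betaOfRecord₉c θ` — β over the continuous-version transport `TcOfRecord` and `chiFixed7` (`rfl`; the form the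
β-side lanes n26∕n24∕n09 quote). [cite: Balaban1987RG1, (1.20)–(1.22) p.264 (bookkeeping)] -/
theorem βfun_datumOfRecord₁₀_eq_betaOfRecord₉c (θ : Stage9Params F N) (h : θ.Provisos₁₀) :
    (datumOfRecord₁₀ F N θ h).βfun = betaOfRecord₉c F N θ := rfl

/-- … and unfolded once more: `= betaOfRecord₈T (TcOfRecord) θ.toStage8Params` (`rfl`). [cite: Balaban1987RG1, (1.20)–(1.22) p.264 (bookkeeping)] -/
theorem βfun_datumOfRecord₁₀_eq_betaOfRecord₈T (θ : Stage9Params F N) (h : θ.Provisos₁₀) :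
    (datumOfRecord₁₀ F N θ h).βfun = betaOfRecord₈T F N (TcOfRecord F N) θ.toStage8Params := rfl

/-- FACE flow: every run's flow is generated FORWARD by (0.20) with the β of record (`rfl`). [cite: Balaban1987RG1, (0.17)–(0.20) pp.255–256 (bookkeeping)] -/
theorem flow_datumOfRecord₁₀ (θ : Stage9Params F N) (h : θ.Provisos₁₀) (p : B12.RunParams) :
    ((datumOfRecord₁₀ F N θ h).C p).flow = genFlow (betaOfRecord₁₀ F N θ) p.g0 := rfl

/-- **ONE HISTORY**: the couplings carried by the run's flow ARE `gOfRecord₁₀ θ p` — the history `χ_k`, the slots and the step weights are indexed by (`rfl`).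
[cite: Balaban1987RG1, (0.17)–(0.20) pp.255–256; Balaban1988Convergent, (2.17)–(2.18) p.257] -/
theorem flow_g_datumOfRecord₁₀ (θ : Stage9Params F N) (h : θ.Provisos₁₀) (p : B12.RunParams) :
    ((datumOfRecord₁₀ F N θ h).C p).flow.g = gOfRecord₁₀ F N θ p := rfl

/-- FACE av: the averaging maps are the averaging operations of record (`rfl`). [cite: Balaban1987RG1, (0.4) p.253 (bookkeeping)] -/
theorem av_datumOfRecord₁₀ (θ : Stage9Params F N) (h : θ.Provisos₁₀) : (datumOfRecord₁₀ F N θ h).av = avOfRecord F N := rfl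

/-- STAGE-0 DATUM CLAUSE at the Stage-10 datum (`rfl`). [cite: Balaban1987RG1, (0.3)–(0.4) p.253] -/
theorem isDatumOfRecord₀_datumOfRecord₁₀ (θ : Stage9Params F N) (h : θ.Provisos₁₀) : IsDatumOfRecord₀ F N (datumOfRecord₁₀ F N θ h) := rfl

/-- **BINDER B1 = NODE N23 AT THE STAGE-9 DATUM**, hypothesis-free beyond the provisos that build it. [cite: Balaban1987RG1, (0.4) p.253] -/
theorem isPrintedAveraged_datumOfRecord₁₀ (θ : Stage9Params F N) (h : θ.Provisos₁₀) : (datumOfRecord₁₀ F N θ h).IsPrintedAveraged :=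
  isPrintedAveraged_datumOfTower F N _ _

/-- FACE χ: the construction's `χ_k` IS def-χ's FIXED-THRESHOLD `chiFixAltOfRecord` (RIDER (R1): flow-blind; `chiFixed7` at any history, `rfl`). [cite: Balaban1988Convergent, (2.17) p.257 (bookkeeping)] -/
theorem chi_stage10 (θ : Stage9Params F N) (h : θ.Provisos₁₀) (p : B12.RunParams) (k : ℕ) :
    ((datumOfRecord₁₀ F N θ h).C p).χ k = chiFixAltOfRecord F N θ.ν p.K k := rfl

/-- FACE actions: background Wilson action, effective action and expansion term ARE def-B's of record at the β of record (`rfl`s). [cite: Balaban1987RG1, (0.17)–(0.23) pp.255–256 (bookkeeping)] -/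
theorem actions_stage10 (θ : Stage9Params F N) (h : θ.Provisos₁₀) (p : B12.RunParams) (k : ℕ) :
    ((datumOfRecord₁₀ F N θ h).C p).wilsonBG k = wilsonBGOfRecord F N θ.εbg p k ∧
      ((datumOfRecord₁₀ F N θ h).C p).effAction k = effActionOfRecordT F N (TcOfRecord F N) (chiFixed7 F N θ.ν) (betaOfRecord₁₀ F N θ) p k ∧
        ((datumOfRecord₁₀ F N θ h).C p).Ek k = EkOfRecordT F N (TcOfRecord F N) (chiFixed7 F N θ.ν) θ.εbg (betaOfRecord₁₀ F N θ) p k :=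
  ⟨rfl, rfl, rfl⟩

/-- FACE `IndAss` (the plug line dag-n09-a (o1) reads): the clause IS def-B's `IndAOfRecord` read at the generated history and the record's objects — Stage 8's
reading VERBATIM (`Iff.rfl`). [cite: Balaban1987RG1, (1.1)–(1.6) pp.260–261 and Thm 3 p.264 (bookkeeping)] -/
theorem indAss_stage10_iff (θ : Stage9Params F N) (h : θ.Provisos₁₀) (p : B12.RunParams) (k : ℕ) :
    ((datumOfRecord₁₀ F N θ h).C p).IndAss k ↔
      IndAOfRecordT F N (TcOfRecord F N) (chiFixed7 F N θ.ν) θ.εbg (betaOfRecord₁₀ F N θ) p k (prefixOf (gOfRecord₁₀ F N θ p) k)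
        (domAltOfRecord F N θ.ν p.K k) (effActionOfRecordT F N (TcOfRecord F N) (chiFixed7 F N θ.ν) (betaOfRecord₁₀ F N θ) p k)
        (wilsonBGOfRecord F N θ.εbg p k) (EkOfRecordT F N (TcOfRecord F N) (chiFixed7 F N θ.ν) θ.εbg (betaOfRecord₁₀ F N θ) p k) := Iff.rfl

/-- FACE `Repr`: the clause IS def-B's `ReprAOfRecord` read at the same arguments (`Iff.rfl`). [cite: Balaban1987RG1, (0.22)–(0.24) p.256 and Thm 1 p.257 (bookkeeping)] -/
theorem repr_stage10_iff (θ : Stage9Params F N) (h : θ.Provisos₁₀) (p : B12.RunParams) (k : ℕ) :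
    ((datumOfRecord₁₀ F N θ h).C p).Repr k ↔
      ReprAOfRecordT F N (TcOfRecord F N) (chiFixed7 F N θ.ν) θ.εbg (betaOfRecord₁₀ F N θ) p k (prefixOf (gOfRecord₁₀ F N θ p) k)
        (domAltOfRecord F N θ.ν p.K k) (effActionOfRecordT F N (TcOfRecord F N) (chiFixed7 F N θ.ν) (betaOfRecord₁₀ F N θ) p k)
        (wilsonBGOfRecord F N θ.εbg p k) (EkOfRecordT F N (TcOfRecord F N) (chiFixed7 F N θ.ν) θ.εbg (betaOfRecord₁₀ F N θ) p k) := Iff.rfl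

/-- FACE `Sect2Form`: the §2 [III] clause IS the residual format predicate READ AT THE REPRESENTED DENSITY `ρ_k = eval rep_k` (`Iff.rfl`). [cite: Balaban1989LargeFieldII, Thm 1 p.355; Balaban1988Convergent, (2.18) p.257 (bookkeeping)] -/
theorem sect2Form_stage10_iff (θ : Stage9Params F N) (h : θ.Provisos₁₀) (p : B12.RunParams) (k : ℕ) :
    ((datumOfRecord₁₀ F N θ h).C p).Sect2Form k ↔ θ.res.S218 p k (densOfRecord₁₀ F N θ p k) := Iff.rfl

/-- **(2.18) HOLDS FOR THE DATUM'S DENSITIES WITH `rep_k` OF RECORD, BY CONSTRUCTION.** [cite: Balaban1988Convergent, (2.18) p.257] -/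
theorem holds_dens_datumOfRecord₁₀ (θ : Stage9Params F N) (h : θ.Provisos₁₀) (K : ℕ) (g₀ : ℝ) (k : ℕ) :
    (reprOfRecord₁₀ F N θ ⟨K, F.m, g₀⟩ k).Holds ((datumOfRecord₁₀ F N θ h).dens K g₀ k) :=
  holds_densOfRecord₁₀ F N θ _ k

/-- (2.18) for the realised `𝐓ρ_k` with `Tstep rep_k` of record, by construction. [cite: Balaban1988Convergent, (3.25) p.270 (bookkeeping)] -/
theorem holds_trho_datumOfRecord₁₀ (θ : Stage9Params F N) (h : θ.Provisos₁₀) (K : ℕ) (g₀ : ℝ) (k : ℕ) :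
    (reprTOfRecord₁₀ F N θ ⟨K, F.m, g₀⟩ k).Holds ((datumOfRecord₁₀ F N θ h).real.Trho K g₀ k) :=
  holds_tdensOfRecord₁₀ F N θ _ k

/-- FACE Wilson start: `ρ₀ = e^{−E}·exp(−A∕g₀²)`. [cite: Balaban1988Convergent, Thm 1 p.262] -/
theorem dens_zero_datumOfRecord₁₀ (θ : Stage9Params F N) (h : θ.Provisos₁₀) (K : ℕ) (g₀ : ℝ) :
    (datumOfRecord₁₀ F N θ h).dens K g₀ 0 = rhoZeroOfRecord F N K g₀ (EOfRecord₁₀ F N θ ⟨K, F.m, g₀⟩) :=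
  densOfRecord₁₀_zero F N θ ⟨K, F.m, g₀⟩

/-- FACE push-forward: `𝐓ρ_k` IS an averaging-of-record image of `ρ_k` (`k < K`; def-T's `isRT_trhoOfRecord9` under the provisos). [cite: Balaban1988Convergent, (3.1) p.264, (3.24)–(3.25) p.270] -/
theorem isRT_trho_datumOfRecord₁₀ (θ : Stage9Params F N) (h : θ.Provisos₁₀) (K : ℕ) (g₀ : ℝ) (k : ℕ) (hk : k < K) :
    IsRT (avOfRecord F N K k).avg ((datumOfRecord₁₀ F N θ h).dens K g₀ k) ((datumOfRecord₁₀ F N θ h).real.Trho K g₀ k) :=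
  (towerOfRecord₁₀ F N θ h).isRT_Trho ⟨K, F.m, g₀⟩ k hk

/-- FACE (0.4) at the step: `∫ρ_{k+1} = ∫𝐓ρ_k` (`k < K`; def-R's (0.3) provisos IN THE SUPPORT FORM via FILE 9′ and FILE 2). [cite: Balaban1989LargeFieldI, (0.4) p.176] -/
theorem integral_dens_succ_datumOfRecord₁₀ (θ : Stage9Params F N) (h : θ.Provisos₁₀) (K : ℕ) (g₀ : ℝ) (k : ℕ) (hk : k < K) :
    ∫ V, (datumOfRecord₁₀ F N θ h).dens K g₀ (k + 1) V ∂fieldMeasure (F.P K) (k + 1) (SU N)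
      = ∫ V, (datumOfRecord₁₀ F N θ h).real.Trho K g₀ k V ∂fieldMeasure (F.P K) (k + 1) (SU N) :=
  (towerOfRecord₁₀ F N θ h).integral_succ ⟨K, F.m, g₀⟩ k hk

/-- `∫ρ_k = ∫ρ₀ (= Z^ε)` along every run, `k ≤ K` (`Tower.integral_eq_integral_zero`). [cite: Balaban1985UV3, (6) p.257] -/
theorem integral_dens_eq_zero_datumOfRecord₁₀ (θ : Stage9Params F N) (h : θ.Provisos₁₀) (K : ℕ) (g₀ : ℝ) (k : ℕ) (hk : k ≤ K) :
    ∫ V, (datumOfRecord₁₀ F N θ h).dens K g₀ k V ∂fieldMeasure (F.P K) k (SU N)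
      = ∫ U, (datumOfRecord₁₀ F N θ h).dens K g₀ 0 U ∂fieldMeasure (F.P K) 0 (SU N) :=
  (towerOfRecord₁₀ F N θ h).integral_eq_integral_zero ⟨K, F.m, g₀⟩ k hk

/-- FACE integrability: every density of the datum, `k ≤ K`, is integrable (from the provisos). [cite: Balaban1988Convergent, (0.2) p.244 (bookkeeping)] -/
theorem integrable_dens_datumOfRecord₁₀ (θ : Stage9Params F N) (h : θ.Provisos₁₀) (K : ℕ) (g₀ : ℝ) (k : ℕ) (hk : k ≤ K) :
    Integrable ((datumOfRecord₁₀ F N θ h).dens K g₀ k) (fieldMeasure (F.P K) k (SU N)) :=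
  isIntegrable_towerOfRecord₁₀ F N θ h ⟨K, F.m, g₀⟩ k hk

/-- … and so is every realised `𝐓ρ_k`, `k < K`. [cite: Balaban1988Convergent, (3.25) p.270 (bookkeeping)] -/
theorem integrable_trho_datumOfRecord₁₀ (θ : Stage9Params F N) (h : θ.Provisos₁₀) (K : ℕ) (g₀ : ℝ) (k : ℕ) (hk : k < K) :
    Integrable ((datumOfRecord₁₀ F N θ h).real.Trho K g₀ k) (fieldMeasure (F.P K) (k + 1) (SU N)) :=
  integrable_towerOfRecord9Supp_Trho h.towerProvisosSupp ⟨K, F.m, g₀⟩ k hk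

/-- The T⁴ apex at the Stage-10 datum, B1 eliminated (`continuumYM4Torus_datumOfTower`). [cite: JaffeWittenClay2006, §6.5 p.11] -/
theorem continuumYM4Torus_datumOfRecord₁₀ (θ : Stage9Params F N) (h : θ.Provisos₁₀)
    (hB : B16.EndStatementBPrinted (datumOfRecord₁₀ F N θ h).C)
    (hE : EndpointExistence (datumOfRecord₁₀ F N θ h).C.toB12)
    (hNE : T4ApexHybrid.HybridNE7Under (datumOfRecord₁₀ F N θ h) (EndpointExistence (datumOfRecord₁₀ F N θ h).C.toB12)) :
    T4ContinuumYM4Torus.ContinuumYM4Torus (datumOfRecord₁₀ F N θ h) :=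
  continuumYM4Torus_datumOfTower F N _ _ hB hE hNE

/-! ## §6. The Stage-10 record predicate (C-binding) -/

/-- **«(D, w) is the record, Stage 10»** (C-binding): admissible Stage-9 parameters SATISFYING THEIR DISPLAYED PROVISOS whose datum of record IS `D`, and a world
bound to its construction with a window `0 < w.γ ≤ θ.γ` (Stage 8's clause: `θ.γ` is the radius of the history box on which the β of record is the merged β),
Bałaban's block size and the C-binding of record over the Stage-8 carriers.  The provisos are an EXISTENTIAL CLAUSE a record certifies — never assumed.
[cite: Balaban1989LargeFieldII, Thm 1 + (0.1) pp.355–356; Balaban1988Convergent, (0.2) p.244, (2.18) p.257; Balaban1989LargeFieldI, (0.2)–(0.4) p.176; Balaban1987RG1, (0.17)–(0.24) pp.255–257 and (1.20)–(1.22) p.264 (objects of record, Stage 9 dictionary)] -/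
def IsRecordOfRecord₁₀C (D : FiniteEpsData F (SU N)) (w : WorldP) : Prop :=
  ∃ (θ : Stage9Params F N) (h : θ.Provisos₁₀), θ.Admissible ∧ D = datumOfRecord₁₀ F N θ h ∧ w.C = D.C ∧ (0 < w.γ ∧ w.γ ≤ θ.γ) ∧
    w.L = (θ.L : ℝ) ∧ ∀ P : B12.RunParams, w.up P = upOfRecord₅C F N (θ.toStage5₁₀ F N) P

/-- **Pointed form**: admissible Stage-9 parameters with their provisos, and a world bound to the construction of their datum, a window, `θ.L` and the upstream
block of record, form a Stage-10 record. [cite: Balaban1989LargeFieldII, Thm 1 + (0.1) pp.355–356 (bookkeeping)] -/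
theorem isRecordOfRecord₁₀C_of_eq (θ : Stage9Params F N) (h : θ.Provisos₁₀) (hθ : θ.Admissible) (w : WorldP)
    (hC : w.C = (datumOfRecord₁₀ F N θ h).C) (hγ : 0 < w.γ ∧ w.γ ≤ θ.γ) (hL : w.L = (θ.L : ℝ))
    (hup : ∀ P, w.up P = upOfRecord₅C F N (θ.toStage5₁₀ F N) P) :
    IsRecordOfRecord₁₀C F N (datumOfRecord₁₀ F N θ h) w :=
  ⟨θ, h, hθ, rfl, hC, hγ, hL, hup⟩

/-- **Every admissible Stage-9 parameter satisfying its provisos IS a Stage-10 record at some world**, with any window `0 < γw ≤ θ.γ` — so inhabitation of the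
record class is EXACTLY «some admissible θ satisfies the displayed provisos». [cite: Balaban1989LargeFieldII, Thm 1 + (0.1) pp.355–356 (bookkeeping)] -/
theorem exists_world_isRecordOfRecord₁₀C (θ : Stage9Params F N) (h : θ.Provisos₁₀) (hθ : θ.Admissible) {γw : ℝ} (hγw : 0 < γw ∧ γw ≤ θ.γ) :
    ∃ w : WorldP, IsRecordOfRecord₁₀C F N (datumOfRecord₁₀ F N θ h) w ∧ w.γ = γw := by
  obtain ⟨w₀⟩ := nonempty_worldP
  exact ⟨{ w₀ with
      C := (datumOfRecord₁₀ F N θ h).C, γ := γw, L := (θ.L : ℝ), one_lt_L := by exact_mod_cast θ.hL.2,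
      up := fun P => upOfRecord₅C F N (θ.toStage5₁₀ F N) P },
    ⟨θ, h, hθ, rfl, rfl, hγw, rfl, fun _ => rfl⟩, rfl⟩

section Consequences

variable {F N}
variable {D : FiniteEpsData F (SU N)} {w : WorldP}

/-- A Stage-10 record CERTIFIES its parameters' provisos and admissibility. [cite: Balaban1989LargeFieldI, (0.3)–(0.4) p.176 (bookkeeping)] -/
theorem exists_provisos_of_isRecordOfRecord₁₀C (h : IsRecordOfRecord₁₀C F N D w) :
    ∃ (θ : Stage9Params F N) (hP : θ.Provisos₁₀), θ.Admissible ∧ D = datumOfRecord₁₀ F N θ hP := by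
  obtain ⟨θ, hP, hθ, hD, -⟩ := h
  exact ⟨θ, hP, hθ, hD⟩

/-- Binding clause 1: the world's construction IS the datum's. [cite: Balaban1989LargeFieldII, Thm 1 p.355 (bookkeeping)] -/
theorem construction_eq_of_isRecordOfRecord₁₀C (h : IsRecordOfRecord₁₀C F N D w) : w.C = D.C := by
  obtain ⟨θ, hP, -, -, hC, -⟩ := h
  exact hC

/-- Binding clause 2: the interval constant is positive (and at most the witness's box radius). [cite: Balaban1989LargeFieldII, Thm 1 p.355 (bookkeeping)] -/
theorem gamma_pos_of_isRecordOfRecord₁₀C (h : IsRecordOfRecord₁₀C F N D w) : 0 < w.γ := by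
  obtain ⟨θ, hP, -, -, -, hγ, -⟩ := h
  exact hγ.1

/-- A Stage-10 record's datum is a datum of record, Stage 0. [cite: Balaban1987RG1, (0.3)–(0.4) p.253 (bookkeeping)] -/
theorem isDatumOfRecord₀_of_isRecordOfRecord₁₀C (h : IsRecordOfRecord₁₀C F N D w) : IsDatumOfRecord₀ F N D := by
  obtain ⟨θ, hP, -, rfl, -⟩ := h
  exact isDatumOfRecord₀_datumOfRecord₁₀ F N θ hP

/-- N23 · binder B1 at every Stage-10 record. [cite: Balaban1987RG1, (0.4) p.253] -/
theorem isPrintedAveraged_of_isRecordOfRecord₁₀C (h : IsRecordOfRecord₁₀C F N D w) : D.IsPrintedAveraged :=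
  isPrintedAveraged_of_isDatumOfRecord₀ F N D (isDatumOfRecord₀_of_isRecordOfRecord₁₀C h)

/-- (2.18) holds for every density of a Stage-10 record's datum, with `rep_k` OF RECORD at the witnessing parameters. [cite: Balaban1988Convergent, (2.18) p.257] -/
theorem holds_dens_of_isRecordOfRecord₁₀C (h : IsRecordOfRecord₁₀C F N D w) :
    ∃ (θ : Stage9Params F N) (hP : θ.Provisos₁₀), θ.Admissible ∧ D = datumOfRecord₁₀ F N θ hP ∧
      ∀ K g₀ k, (reprOfRecord₁₀ F N θ ⟨K, F.m, g₀⟩ k).Holds (D.dens K g₀ k) := by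
  obtain ⟨θ, hP, hθ, rfl, -⟩ := h
  exact ⟨θ, hP, hθ, rfl, fun K g₀ k => holds_dens_datumOfRecord₁₀ F N θ hP K g₀ k⟩

/-- **A Stage-10 record's 𝐑-leaf IS law transport along its tower of record**, at every run (the junction hypothesis `hR9` of N11∕N13 at ₁₀, unfolded).
[cite: Balaban1988Convergent, p.244; Balaban1989LargeFieldII, Thm 1 p.355 (bookkeeping)] -/
theorem exists_rOperation_iff_of_isRecordOfRecord₁₀C (h : IsRecordOfRecord₁₀C F N D w) :
    ∃ (θ : Stage9Params F N) (hP : θ.Provisos₁₀), θ.Admissible ∧ D = datumOfRecord₁₀ F N θ hP ∧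
      ∀ P : B12.RunParams, (leavesP w P).rOperation ↔ ∀ k, k < P.K → TLaw₁₀ F N θ P k → SLaw₁₀ F N θ P (k + 1) := by
  obtain ⟨θ, hP, hθ, hD, -, -, -, hup⟩ := h
  refine ⟨θ, hP, hθ, hD, fun P => ?_⟩
  show (w.up P).rOperation ↔ _
  rw [hup P]
  exact rOperation_upOfRecord₅C_stage10_iff F N θ P

end Consequences

/-! ## §7. The shadow; refinement to the Stage-5 record predicate AT THE SHADOW; transfer of world-reading theorems -/

/-- **THE SHADOW RESIDUAL of `θ` under its provisos**: the Stage-10 residual with `R :=` the density operation induced AT THE RADON–NIKODYM IMAGE of the tower of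
record (`Tower.shadowR`: `rnTransport ρ_k ↦ ρ_{k+1}`, identity elsewhere; its (0.4) and integrability preservation are dag-n23-a's
`preservesIntegral_shadowR_towerOfRecord9Supp` ∕ `integrable_shadowR_towerOfRecord9Supp` at the provisos) and the format slot FROZEN at the density of record (`S218 p k _ := θ.res.S218 p k (densOfRecord₁₀ θ p k)`, read only there).  A
PROOF DEVICE for the refinement below — never an object of record. [cite: Balaban1989LargeFieldI, (0.2)–(0.4) p.176; Balaban1987RG1, (0.13) p.254 (bookkeeping)] -/
def shadowResidual₁₀ (θ : Stage9Params F N) (h : θ.Provisos₁₀) : Residual₅ F N :=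
  { residualOfStage10 F N θ with
    R := fun p k => (towerOfRecord₁₀ F N θ h).shadowR p k
    preservesIntegral_R := fun p k hk => preservesIntegral_shadowR_towerOfRecord9Supp h.towerProvisosSupp p k hk
    integrable_R := fun p k hk => integrable_shadowR_towerOfRecord9Supp h.towerProvisosSupp p k hk
    S218 := fun p k _ => θ.res.S218 p k (densOfRecord₁₀ F N θ p k) }

/-- **THE SHADOW Stage-5 parameters of `θ`** at interval letter `γ'`: `θ`'s Stage-3 dictionary, `γ := γ'`, residual := the shadow residual.
[cite: Balaban1989LargeFieldI, (0.2) p.176 (bookkeeping)] -/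
def shadow₅OfRecord₁₀ (θ : Stage9Params F N) (h : θ.Provisos₁₀) (γ' : ℝ) : Stage5Params F N :=
  { θ.toStage5Params with γ := γ', res := shadowResidual₁₀ F N θ h }

/-- THE KEY `rfl`: the machine of the shadow has core `coreOfRecord₁₀ θ` — so the tower of record IS a tower over it. [cite: Balaban1988Convergent, (0.2) p.244 (bookkeeping)] -/
theorem toCore_machineOfRecord₅_shadow₁₀ (θ : Stage9Params F N) (h : θ.Provisos₁₀) (γ' : ℝ) :
    (machineOfRecord₅ F N (shadow₅OfRecord₁₀ F N θ h γ')).toCore = coreOfRecord₁₀ F N θ := rfl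

/-- The shadow's residual `R` IS the tower's shadow operation (`rfl`). [cite: Balaban1989LargeFieldI, (0.3) p.176 (bookkeeping)] -/
theorem res_R_shadow₁₀ (θ : Stage9Params F N) (h : θ.Provisos₁₀) (γ' : ℝ) (p : B12.RunParams) (k : ℕ) :
    (shadow₅OfRecord₁₀ F N θ h γ').res.R p k = (towerOfRecord₁₀ F N θ h).shadowR p k := rfl

/-- The shadow is Stage-5 admissible iff `θ`'s Stage-1 dictionary is admissible and `0 < γ'`. [cite: Balaban1989LargeFieldII, Thm 1 p.355 (bookkeeping)] -/
theorem admissible_shadow₁₀ (θ : Stage9Params F N) (h : θ.Provisos₁₀) {γ' : ℝ} (hθ : θ.Admissible) (hγ' : 0 < γ') :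
    (shadow₅OfRecord₁₀ F N θ h γ').Admissible :=
  ⟨hθ.1.1.1.1, hγ'⟩

/-- The shadow's upstream block IS the Stage-10 view's (`rfl`: it reads the Stage-3 dictionary and the carriers only). [cite: Balaban1985UV3, Thm 1 p.257 (bookkeeping)] -/
theorem upOfRecord₅C_shadow₁₀ (θ : Stage9Params F N) (h : θ.Provisos₁₀) (γ' : ℝ) (P : B12.RunParams) :
    upOfRecord₅C F N (shadow₅OfRecord₁₀ F N θ h γ') P = upOfRecord₅C F N (θ.toStage5₁₀ F N) P := rfl

/-- The shadow datum has the SAME CONSTRUCTION as the Stage-10 datum (n23-a's `datumOfRecord_C_eq_datumOfTower`). [cite: Balaban1989LargeFieldII, Thm 1 + (0.1) pp.355–356 (bookkeeping)] -/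
theorem datumOfRecord₅_shadow₁₀_C (θ : Stage9Params F N) (h : θ.Provisos₁₀) (γ' : ℝ) :
    (datumOfRecord₅ F N (shadow₅OfRecord₁₀ F N θ h γ')).C = (datumOfRecord₁₀ F N θ h).C :=
  datumOfRecord_C_eq_datumOfTower F N (machineOfRecord₅ F N (shadow₅OfRecord₁₀ F N θ h γ')) (towerOfRecord₁₀ F N θ h) (fun _ _ => rfl)

/-- … the same densities. [cite: Balaban1988Convergent, (0.2) p.244 (bookkeeping)] -/
theorem dens_datumOfRecord₅_shadow₁₀ (θ : Stage9Params F N) (h : θ.Provisos₁₀) (γ' : ℝ) (K : ℕ) (g₀ : ℝ) (k : ℕ) :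
    (datumOfRecord₅ F N (shadow₅OfRecord₁₀ F N θ h γ')).dens K g₀ k = (datumOfRecord₁₀ F N θ h).dens K g₀ k :=
  dens_datumOfRecord_eq_datumOfTower F N (machineOfRecord₅ F N (shadow₅OfRecord₁₀ F N θ h γ')) (towerOfRecord₁₀ F N θ h) (fun _ _ => rfl) K g₀ k

/-- … NODE 00's Stage-5 density tower at the shadow IS the density of record. [cite: Balaban1988Convergent, (0.2) p.244 (bookkeeping)] -/
theorem densOfRecord₅_shadow₁₀ (θ : Stage9Params F N) (h : θ.Provisos₁₀) (γ' : ℝ) (p : B12.RunParams) (k : ℕ) :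
    densOfRecord₅ F N (shadow₅OfRecord₁₀ F N θ h γ') p k = densOfRecord₁₀ F N θ p k :=
  densOfRecord₅_eq_tower F N (shadow₅OfRecord₁₀ F N θ h γ') (towerOfRecord₁₀ F N θ h) (fun _ _ => rfl) p k

/-- … the same β-functions (`rfl`). [cite: Balaban1987RG1, (1.22) p.264 (bookkeeping)] -/
theorem βfun_datumOfRecord₅_shadow₁₀ (θ : Stage9Params F N) (h : θ.Provisos₁₀) (γ' : ℝ) :
    (datumOfRecord₅ F N (shadow₅OfRecord₁₀ F N θ h γ')).βfun = (datumOfRecord₁₀ F N θ h).βfun := rfl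

/-- … and the same averaging maps (`rfl`). [cite: Balaban1987RG1, (0.4) p.253 (bookkeeping)] -/
theorem av_datumOfRecord₅_shadow₁₀ (θ : Stage9Params F N) (h : θ.Provisos₁₀) (γ' : ℝ) :
    (datumOfRecord₅ F N (shadow₅OfRecord₁₀ F N θ h γ')).av = (datumOfRecord₁₀ F N θ h).av := rfl

/-- **A STAGE-9 WORLD IS A STAGE-5 RECORD AT THE SHADOW DATUM** (n23-a's `isRecordOfRecord₅C_shadow`, witness: the shadow at the world's own letter `w.γ`).
[cite: Balaban1989LargeFieldII, Thm 1 + (0.1) pp.355–356; Balaban1988Convergent, (0.2) p.244 (objects of record, bookkeeping)] -/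
theorem isRecordOfRecord₅C_shadow₁₀ (θ : Stage9Params F N) (h : θ.Provisos₁₀) (hθ : θ.Admissible) (w : WorldP)
    (hC : w.C = (datumOfRecord₁₀ F N θ h).C) (hγ : 0 < w.γ) (hL : w.L = (θ.L : ℝ))
    (hup : ∀ P, w.up P = upOfRecord₅C F N (θ.toStage5₁₀ F N) P) :
    IsRecordOfRecord₅C F N (datumOfRecord₅ F N (shadow₅OfRecord₁₀ F N θ h w.γ)) w :=
  isRecordOfRecord₅C_shadow F N (shadow₅OfRecord₁₀ F N θ h w.γ) (admissible_shadow₁₀ F N θ h hθ hγ) (towerOfRecord₁₀ F N θ h)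
    (fun _ _ => rfl) w hC rfl hL hup

variable {F N}

/-- **REFINEMENT `IsRecordOfRecord₁₀C → IsRecordOfRecord₅C` AT THE SHADOW**: every Stage-10 record's world is a Stage-5 record at a datum with THE SAME
construction, densities, β-functions and averaging maps.  (NOT at `D` itself — located: the Stage-5 datum's realised `Tρ_k` is the Radon–Nikodym transport.)
[cite: Balaban1989LargeFieldII, Thm 1 + (0.1) pp.355–356; Balaban1988Convergent, (0.2) p.244 (bookkeeping)] -/
theorem exists_isRecordOfRecord₅C_of_isRecordOfRecord₁₀C {D : FiniteEpsData F (SU N)} {w : WorldP} (h : IsRecordOfRecord₁₀C F N D w) :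
    ∃ D₅ : FiniteEpsData F (SU N), IsRecordOfRecord₅C F N D₅ w ∧ D₅.C = D.C ∧ (∀ K g₀ k, D₅.dens K g₀ k = D.dens K g₀ k) ∧
      D₅.βfun = D.βfun ∧ D₅.av = D.av := by
  obtain ⟨θ, hP, hθ, rfl, hC, ⟨hγ0, -⟩, hL, hup⟩ := h
  exact ⟨_, isRecordOfRecord₅C_shadow₁₀ F N θ hP hθ w hC hγ0 hL hup, datumOfRecord₅_shadow₁₀_C F N θ hP w.γ,
    dens_datumOfRecord₅_shadow₁₀ F N θ hP w.γ, rfl, rfl⟩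

/-- **TRANSFER**: every node statement established over the Stage-5 record predicate in the `AtRecord` shape (`h₅`) holds at every run of every Stage-10 record's
world. [cite: Balaban1989LargeFieldII, Thm 1 p.355 (bookkeeping)] -/
theorem atWorld_of_isRecordOfRecord₁₀C {X : Dag.Leaves → Prop}
    (h₅ : ∀ (D : FiniteEpsData F (SU N)) (w : WorldP), IsRecordOfRecord₅C F N D w → ∀ P : B12.RunParams, X (leavesP w P))
    {D : FiniteEpsData F (SU N)} {w : WorldP} (h : IsRecordOfRecord₁₀C F N D w) (P : B12.RunParams) : X (leavesP w P) := by
  obtain ⟨D₅, h5, -⟩ := exists_isRecordOfRecord₅C_of_isRecordOfRecord₁₀C h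
  exact h₅ D₅ w h5 P

section Transferred

variable {D : FiniteEpsData F (SU N)} {w : WorldP}

/-- Instance · GUARDED (0.20) at every Stage-10 record (the Stage-5 theorem, transferred). [cite: Balaban1987RG1, (0.20) p.256] -/
theorem rgFlow_of_smallCouplings_of_isRecordOfRecord₁₀C (h : IsRecordOfRecord₁₀C F N D w) (P : B12.RunParams)
    (hsc : (leavesP w P).smallCouplings) : (leavesP w P).rgFlow := by
  obtain ⟨D₅, h5, -⟩ := exists_isRecordOfRecord₅C_of_isRecordOfRecord₁₀C h
  exact rgFlow_of_smallCouplings_of_isRecordOfRecord₅C h5 P hsc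

/-- Instance · N01 `Dag.B4_main` at every run of every Stage-10 record. [cite: Balaban1983RegularityDecay, Theorem p.573 (kernel version, transferred)] -/
theorem b4_main_of_isRecordOfRecord₁₀C (h : IsRecordOfRecord₁₀C F N D w) (P : B12.RunParams) : Dag.B4_main (leavesP w P) :=
  atWorld_of_isRecordOfRecord₁₀C (fun _ _ h5 P => b4_main_of_isRecordOfRecord₅C h5 P) h P

/-- Instance · N02 `Dag.B5_main` at every run of every Stage-10 record. [cite: Balaban1984PropagatorsI, Props. 1.1–1.2 pp.33–36 (kernel versions, transferred)] -/
theorem b5_main_of_isRecordOfRecord₁₀C (h : IsRecordOfRecord₁₀C F N D w) (P : B12.RunParams) : Dag.B5_main (leavesP w P) :=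
  atWorld_of_isRecordOfRecord₁₀C (fun _ _ h5 P => b5_main_of_isRecordOfRecord₅C h5 P) h P

/-- Instance · N04 `Dag.B7_main` at every run of every Stage-10 record. [cite: Balaban1985Averaging, Props. 1–10 pp.26–50 (kernel version, transferred)] -/
theorem b7_main_of_isRecordOfRecord₁₀C (h : IsRecordOfRecord₁₀C F N D w) (P : B12.RunParams) : Dag.B7_main (leavesP w P) :=
  atWorld_of_isRecordOfRecord₁₀C (fun _ _ h5 P => b7_main_of_isRecordOfRecord₅C h5 P) h P

/-- Instance · **the END headline at a Stage-10 record needs NO `rgFlow` binder**: nodes at every run + the β-window binder ⇒ `B16.EndStatementBPrinted D.C`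
(the Stage-5 theorem at the shadow, then `D₅.C = D.C`). [cite: Balaban1989LargeFieldII, Thm 1 p.355 + p.391] -/
theorem endStatementBPrinted_of_isRecordOfRecord₁₀C_of_nodes (h : IsRecordOfRecord₁₀C F N D w) {γ₀ : ℝ} (hγ₀ : w.γ ≤ γ₀)
    (hnodes : ∀ P, Nodes (leavesP w P)) (hβ : BetaBoundsInInterval w.C.toB12 γ₀ w.b w.βup) :
    B16.EndStatementBPrinted D.C := by
  obtain ⟨D₅, h5, hC5, -⟩ := exists_isRecordOfRecord₅C_of_isRecordOfRecord₁₀C h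
  rw [← hC5]
  exact endStatementBPrinted_of_isRecordOfRecord₅C_of_nodes h5 hγ₀ hnodes hβ

end Transferred


/-! ## §8. The β-VERSION faces (RIDER №6 (b)): what the proviso `contT` buys at the record -/

section BetaVersion

variable {D : FiniteEpsData F (SU N)} {w : WorldP}

/-- The Stage-10 provisos CARRY the β-version proviso (plan (c1)). [cite: Balaban1987RG1, (0.13) p.254 and (0.19) p.255 (bookkeeping)] -/
theorem Stage9Params.Provisos₁₀.hasContTransportAlong {θ : Stage9Params F N} (h : θ.Provisos₁₀) : θ.toStage8Params.HasContTransportAlong :=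
  h.contT

/-- FACE `A_{k+1}` AT THE β-TRANSPORT: the core's effective action at step `k+1` IS (0.19)'s `log(𝐍_k⁻¹ · (T_k(χ_k e^{−GF∕g_k²+A_k}))(V))` with `T_k := TcOfRecord`,
`χ_k := chiFixed7 θ.ν` along the generated history (`rfl`) — the POINT VALUES this record's β reads. [cite: Balaban1987RG1, (0.19) p.255 (bookkeeping)] -/
theorem effAction_succ_stage10 (θ : Stage9Params F N) (h : θ.Provisos₁₀) (p : B12.RunParams) (k : ℕ) (V : GaugeField (F.P p.K) (k + 1) (SU N)) :
    ((datumOfRecord₁₀ F N θ h).C p).effAction (k + 1) V =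
      Real.log ((normConstHT F N (TcOfRecord F N) (chiFixed7 F N θ.ν) p.K (gOfRecord₁₀ F N θ p) k)⁻¹ *
        TcOfRecord F N p.K k (integrand (chiFixed7 F N θ.ν p.K (gOfRecord₁₀ F N θ p) k) (gfOfRecord F N p.K k) (gOfRecord₁₀ F N θ p k)
          (effActionHT F N (TcOfRecord F N) (chiFixed7 F N θ.ν) p.K (gOfRecord₁₀ F N θ p) k)) V) := rfl

/-- FACE `𝐍_k` AT THE β-TRANSPORT: the normalisation constant IS the continuous-version transform EVALUATED AT THE UNIT CONFIGURATION `V = 1` (`rfl`) — a point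
value, now of a pointwise-determined object. [cite: Balaban1987RG1, (0.19) p.255–256 (bookkeeping)] -/
theorem normConst_stage10 (θ : Stage9Params F N) (p : B12.RunParams) (k : ℕ) :
    normConstHT F N (TcOfRecord F N) (chiFixed7 F N θ.ν) p.K (gOfRecord₁₀ F N θ p) k =
      TcOfRecord F N p.K k (integrand (chiFixed7 F N θ.ν p.K (gOfRecord₁₀ F N θ p) k) (gfOfRecord F N p.K k) (gOfRecord₁₀ F N θ p k)
        (effActionHT F N (TcOfRecord F N) (chiFixed7 F N θ.ν) p.K (gOfRecord₁₀ F N θ p) k)) 1 := rfl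

/-- **UNDER THE PROVISOS, EVERY β-INPUT IS A VERSION OF FILE 1's KERNEL TRANSFORM AND CONTINUOUS** — at every torus `K`, history `g`, step `k < K`
(FILE 4's `ae_eq_and_continuous_of_hasContTransportAlong` at `contT`). [cite: Balaban1987RG1, (0.13) p.254, (0.19) p.255 (bookkeeping)] -/
theorem betaInput_ae_eq_and_continuous₁₀ {θ : Stage9Params F N} (h : θ.Provisos₁₀) {K : ℕ} (g : ℕ → ℝ) {k : ℕ} (hk : k < K) :
    ((fun V : PBond (F.P K) (k + 1) → SU N => TcOfRecord F N K k (integrand (chiFixed7 F N θ.ν K g k) (gfOfRecord F N K k) (g k)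
        (effActionHT F N (TcOfRecord F N) (chiFixed7 F N θ.ν) K g k)) V) =ᵐ[piHaar (F.P K) (k + 1) (SU N)]
      (fun V => transportOfRecord F N K k (integrand (chiFixed7 F N θ.ν K g k) (gfOfRecord F N K k) (g k)
        (effActionHT F N (TcOfRecord F N) (chiFixed7 F N θ.ν) K g k)) V)) ∧
    Continuous (fun V : PBond (F.P K) (k + 1) → SU N => TcOfRecord F N K k (integrand (chiFixed7 F N θ.ν K g k) (gfOfRecord F N K k) (g k)
        (effActionHT F N (TcOfRecord F N) (chiFixed7 F N θ.ν) K g k)) V) :=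
  ae_eq_and_continuous_of_hasContTransportAlong h.contT g hk

/-- **DETERMINACY OF THE β-INPUTS (RIDER №6 (b) at the record)**: ANY continuous a.e.-representative `gc` of the kernel transform of the β-layer's density IS the
input this record's β reads — at EVERY coarse field `V` (hence also `𝐍_k = gc 1`).  Hypothesis-free beyond `gc`'s two properties. [cite: Balaban1987RG1, (0.13) p.254, (0.19) p.255 (bookkeeping)] -/
theorem betaInput_eq_of_continuous₁₀ (θ : Stage9Params F N) {K k : ℕ} (g : ℕ → ℝ) {gc : (PBond (F.P K) (k + 1) → SU N) → ℝ} (hgc : Continuous gc)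
    (hae : gc =ᵐ[piHaar (F.P K) (k + 1) (SU N)] (fun V => transportOfRecord F N K k (integrand (chiFixed7 F N θ.ν K g k) (gfOfRecord F N K k) (g k)
        (effActionHT F N (TcOfRecord F N) (chiFixed7 F N θ.ν) K g k)) V)) :
    TcOfRecord F N K k (integrand (chiFixed7 F N θ.ν K g k) (gfOfRecord F N K k) (g k)
        (effActionHT F N (TcOfRecord F N) (chiFixed7 F N θ.ν) K g k)) = gc :=
  TcOfRecord_eq_of_continuous hgc hae

/-- **A STAGE-10 RECORD CERTIFIES THE β-VERSION PROVISO** and names its β: `D.βfun = betaOfRecord₉c θ` for parameters whose β-inputs all have continuous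
transforms. [cite: Balaban1987RG1, (1.20)–(1.22) p.264, (0.13) p.254 (bookkeeping)] -/
theorem exists_betaVersion_of_isRecordOfRecord₁₀C (h : IsRecordOfRecord₁₀C F N D w) :
    ∃ (θ : Stage9Params F N) (hP : θ.Provisos₁₀), θ.Admissible ∧ D = datumOfRecord₁₀ F N θ hP ∧ D.βfun = betaOfRecord₉c F N θ ∧
      θ.toStage8Params.HasContTransportAlong := by
  obtain ⟨θ, hP, hθ, rfl, -⟩ := h
  exact ⟨θ, hP, hθ, rfl, rfl, hP.contT⟩

end BetaVersion

end Literature.MathematicalPhysics.QuantumFieldTheory.Balaban1983to89.Node00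

end
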